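import Summits.QuantumFields.YangMills.Theorems.BalabanUVNodesN21LowCentreEndAtSUNBlockChartPackageCoercive
import Summits.QuantumFields.YangMills.Theorems.BalabanUVNodesN21ChartExponentCoercivityAxialComb

/-!
# N21 (NE7c) · THE [LF-II] §1-LETTERS END ON THE EXPONENTIAL `SU(N)` BLOCK CHART, XI: file 20's per-fibre CHART PACKAGE ∕ (M1) ENDs with `h19`
# from the (1.7) row, ON THE OFF-TREE BLOCK `castBond '' (innerBonds n y ∖ treeBonds n y)` OF A TORUS BOX — no bond dictionary displayed: dag-n21-w3
# g5's `…CoercivityAxialComb.ineq19_blockChartSU_image_of_ineq17` supplies it (the lane's comb-gauge box `[lo, hi]` is the case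
# `n = sides, y = lo`, `castBond_injOn_innerBonds`)

Width seat pub-ymgap-dag-n21-w1 (g4; director-ym №197 ∕ HUMAN RULING D-0149), node N21 = NE7c (NOT PRINTED in [Bałaban 1983–89], NOT proved), lane K3⁸
`SpineGivenEndpointR13SepCoPHV` (stmt-QuantumFields-27366, KEY MAP v2; lineage K3⁷ 20544), `--kind proof --supports … --as helper`.  File 31 of the seat's chain —
the `_offComb` half of the re-knit dag-n21-w3 g5 worded «yours if wanted» (bus 2026-08-28 13:40Z, DECL-DELTA-23).  THEOREMS ONLY: 0 `def`, 0 `sorry`; count-neutral.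
Imports file 20 `…PackageCoercive` (p621358) and dag-n21-w3 g5's `…ChartExponentCoercivityAxialComb` (part II of INTENT-23).  NO Theses import.  Restates nothing;
composes BY NAME.

WHAT IS PROVED ([bookkeeping]: `subst` + one `exact` each — file 20's three theorems with the cube dictionary `(n, y, e)` REPLACED by a `ℤ^d` box `box n y`
(`n y : Fin P.d → …`, sides `n_κ ≤ 100M`) with `castBond` injective on its inner bonds, the block PINNED to `b = castBond '' (innerBonds n y ∖ treeBonds n y)`
(hypothesis `hbdef`), the (1.7) row asked against the zero-extension `bd ↦ v ⟨castBond bd⟩`, and `h19 := ineq19_blockChartSU_image_of_ineq17 hinj M hd hnM hM Qf hγ₀.le h17 hsmall`).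
* ★ `chartAC_of_sect1Letters_analyticLocal_of_ineq17_image` · ★ `cutChartLawAC_of_sect1Letters_analyticLocal_of_ineq17_image` ·
  ★★ `chartPackage_of_sect1Letters_analyticLocal_of_ineq17_image` — at the lane's comb-gauge box `[lo, hi]` take `n κ = (hi κ + 1 − lo κ).toNat`, `y = lo`,
  `hinj := castBond_injOn_innerBonds hN`, `hnM := sides_le_of_le hsides` (dag-n21-w3's part I).

HONEST FRAMING.  Composition BY NAME of landed files (dag-n21-w3 g5's parts I∕II credited); the (1.7) row `h17` (about Bałaban's `Δ₁(ζ₀)`), the dressed presentation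
`hR`, the (1.2) expansion's identification, the analyticity letter, the statistic binders, the odds and the clauses remain the consumer's HYPOTHESES (NODE O's term
object ∕ located letters); which box ∕ comb the (M1) package uses is the measure side's decision (dag-n21-w2 ∕ dag-n21-d; junction №5); nothing of Bałaban's asserted;
(M1) ∕ NE7c NOT PRINTED ∕ NOT proved; **N21 NOT discharged**; K3⁸ NOT claimed; counts unmoved (typed 28∕28 · discharged 5∕27); never a count claim; one finite 𝕋⁴ at
fixed ε — R4 would close only the conditional finite-𝕋⁴ rung `BalabanLadder.UV`, NOT the Yang–Mills mass gap (Clay); nothing about ℝ⁴ ∕ OS.  No decl below carries a cite tag.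
-/

set_option autoImplicit false

noncomputable section

open MeasureTheory Set Function Finset Metric
open scoped ENNReal BigOperators Matrix

namespace Summit.QuantumFields.YangMills.Theorems.N21LowCentreEndAtSUNBlockChartPackageCoerciveAxialComb

open Literature.MathematicalPhysics.QuantumFieldTheory.Balaban1983to89
open Literature.MathematicalPhysics.QuantumFieldTheory.Balaban1983to89.T4Continuum
open Literature.MathematicalPhysics.QuantumFieldTheory.Balaban1983to89.Node00 hiding dimSU
open Literature.MathematicalPhysics.QuantumFieldTheory.Balaban1983to89.T4ShellMeasure (SlotAntiConcentration)
open Literature.MathematicalPhysics.QuantumFieldTheory.Balaban1983to89.T4ShellMeasureDet (blockLaw)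
open Literature.MathematicalPhysics.QuantumFieldTheory.Balaban1983to89.B16Sect1Wilson (Ineq16 Ineq17 Ineq19)
open Literature.MathematicalPhysics.QuantumFieldTheory.Balaban1983to89.B6TreeGaugePoincare (curl)
open Literature.MathematicalPhysics.QuantumFieldTheory.Balaban1983to89.B16Eq18Proof (innerBonds treeBonds innerPlaq)
open Summit.QuantumFields.BalabanUV.T4Continuum
open Summit.QuantumFields.BalabanUV.T4Continuum.ShellMeasureExpChartSUN (SUN ChartSU BlockChartSU dimSU expFibreChartSU chartWeightSU)
open Summit.QuantumFields.BalabanUV.T4Continuum.ShellMeasureScalingSUN (windowSU)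
open Summit.QuantumFields.BalabanUV.T4Continuum.ShellMeasureExpJacobianSUN (expJacWeightSU)
open Summit.QuantumFields.BalabanUV.T4Continuum.ShellMeasureExpHaarAreaSUN (kappaSU)
open Summit.QuantumFields.BalabanUV.T4Continuum.ShellMeasureExpDuhamelSUN (duhT)
open Summit.QuantumFields.YangMills.Theorems.N21ShellSplitOfRecord13CoPH (blockReading)
open Summit.QuantumFields.YangMills.Theorems.N21LowCentreEndAtSUNBlockChartAnalytic
  (cutChartLawAC_of_sect1Letters_analyticLocal chartAC_of_sect1Letters_analyticLocal)
open Summit.QuantumFields.YangMills.Theorems.N21LowCentreEndAtSUNBlockChartPackage (chartPackage_of_sect1Letters_analyticLocal)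
open Literature.MathematicalPhysics.QuantumFieldTheory.Balaban1983to89.T4AxialGaugeSmallField (castSite)
open Summit.QuantumFields.YangMills.Theorems.N21ChartExponentCoercivityAxialComb (ineq19_blockChartSU_image_of_ineq17)

variable {N : ℕ} [NeZero N] {P : Params} {j : ℕ}

/-- ★ **THE (M1) END AT A BLOCK STATISTIC READ IN THE CHART, `h19` FROM THE (1.7) ROW, ON THE OFF-TREE BLOCK OF A TORUS BOX** — file 20's ★ with the cube dictionary replaced by the block `b = castBond '' (innerBonds n y ∖ treeBonds n y)` of a `ℤ^d` box on whose inner bonds `castBond` is injective (sides `n_κ ≤ 100M`), and `h19` produced by dag-n21-w3 g5's `ineq19_blockChartSU_image_of_ineq17`. [bookkeeping] -/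
theorem chartAC_of_sect1Letters_analyticLocal_of_ineq17_image (hN : 2 ≤ N) (b : Finset (PBond P j)) (hb : b.Nonempty)
    {S : ℝ} (hS : 0 < S) (hSπ : S < Real.pi) (c : GaugeField P j (SU N)) (R : (↥b → SU N) → ℝ≥0∞)
    (u : GaugeField P j (SU N) → ℝ) (x : GaugeField P j (SU N))
    (K₀ : Set (BlockChartSU N b)) (A Qf lin Vt : BlockChartSU N b → ℝ)
    (hAm : Measurable fun z : BlockChartSU N b => K₀.indicator (fun w => ENNReal.ofReal (Real.exp (-A w))) z)
    {U : BlockChartSU N b → ℝ} (hUm : Measurable U)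
    {C Env : Set (BlockChartSU N b)} (hC : MeasurableSet C) (hEnv : MeasurableSet Env)
    {θ ρ σ κ₀ Q L γ₀ B₃ M₀ A₀ p₀g Rk WV r S₂ Cc εk : ℝ} (M : ℕ) {n : Fin P.d → ℕ}
    (hθ : 0 < θ) (hρ0 : 0 < ρ) (hρ1 : ρ < 1) (hρσ : ρ + σ ≤ 1) (hκ : 0 < κ₀) (hQ0 : 0 ≤ Q) (hL : 0 < L)
    (hd : 1 ≤ P.d) (hM : 0 < M) (hγ₀ : 0 < γ₀) (hr : 0 < r)
    (hW : 0 ≤ 3 * B₃ * M₀ * A₀ ^ 2 * p₀g ^ 2 * Real.exp (-Rk) * (100 * (M : ℝ)) ^ 4 + WV)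
    (hK₀ : Convex ℝ K₀) (h0K₀ : (0 : BlockChartSU N b) ∈ K₀)
    (hexp : ∀ v ∈ K₀, A v = A 0 + 1 / 2 * Qf v + lin v + Vt v)
    (Mq : Matrix (↥b × Fin (dimSU N)) (↥b × Fin (dimSU N)) ℝ)
    (hQf : ∀ v, Qf v = (fun q : ↥b × Fin (dimSU N) => v q.1 q.2) ⬝ᵥ (Mq *ᵥ fun q => v q.1 q.2))
    -- the (1.7) row on the block `castBond '' (innerBonds n y ∖ treeBonds n y)` of a box with `castBond` injective, replacing `h19`
    (hnM : ∀ κ, n κ ≤ 100 * M) (y : Fin P.d → ℤ)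
    (hinj : Set.InjOn (fun bd : (Fin P.d → ℤ) × Fin P.d => (⟨castSite bd.1, bd.2⟩ : PBond P j)) ↑(innerBonds n y))
    (hbdef : b = (innerBonds n y \ treeBonds n y).image fun bd : (Fin P.d → ℤ) × Fin P.d => (⟨castSite bd.1, bd.2⟩ : PBond P j))
    (h17 : ∀ v : BlockChartSU N b, Ineq17 (Qf v)
      (∑ p ∈ innerPlaq n y, ∑ a : Fin (dimSU N),
        curl (fun bd => if h : (⟨castSite bd.1, bd.2⟩ : PBond P j) ∈ b then v ⟨(⟨castSite bd.1, bd.2⟩ : PBond P j), h⟩ a else (0 : ℝ))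
          p.1 p.2.1 p.2.2 ^ 2)
      (∑ i, ‖v i‖ ^ 2) γ₀ Cc M Rk εk)
    (hsmall : Cc * ((M : ℝ) ^ 6 * Rk * εk + Real.exp (-Rk)) ≤ γ₀ / (2 * P.d * (100 * (M : ℝ)) ^ (P.d + 1)))
    (ℓ : BlockChartSU N b →ₗ[ℝ] ℝ) (hlin : ∀ v, lin v = ℓ v)
    (h16 : ∀ v ∈ K₀, Ineq16 (lin v) B₃ M₀ A₀ p₀g Rk M)
    (hV : ∀ v ∈ K₀, |Vt v| ≤ WV)
    (Φ : (↥b × Fin (dimSU N) → ℂ) → ℂ)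
    (hVt : ∀ x ∈ K₀, Vt x = (Φ fun q => ((x q.1 q.2 : ℝ) : ℂ)).re)
    (hΦd : ∀ x ∈ K₀, DifferentiableOn ℂ Φ (ball (fun q => ((x q.1 q.2 : ℝ) : ℂ)) r))
    (hΦS : ∀ x ∈ K₀, ∀ u ∈ ball (fun q : ↥b × Fin (dimSU N) => ((x q.1 q.2 : ℝ) : ℂ)) r, ‖Φ u‖ ≤ S₂)
    (hclause₂ : 4 * P.d * (100 * (M : ℝ)) ^ (P.d + 1) * S₂ ≤ γ₀ * r ^ 2)
    (hUL : ∀ z z' : BlockChartSU N b, U z - U z' ≤ L * ‖z - z'‖)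
    (hUc : U 0 ≤ σ * θ)
    (hclause : 16 * (3 * B₃ * M₀ * A₀ ^ 2 * p₀g ^ 2 * Real.exp (-Rk) * (100 * (M : ℝ)) ^ 4 +
        (WV + b.card * ((N * N : ℕ) * (-2 * Real.log (Real.sinc S))))) * P.d
      * (100 * (M : ℝ)) ^ (P.d + 1) * (dimSU N * L ^ 2) ≤ γ₀ * (θ * (1 - ρ - σ)) ^ 2)
    (henv : ∀ l ∈ Icc (1 - 1 / ((b.card : ℝ) * dimSU N + 1)) 1, ∀ z : BlockChartSU N b,
      θ * (1 - ρ) ≤ U z → U z < θ → z ∈ C → l • z ∈ Env)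
    (hRT : ∀ z : BlockChartSU N b, θ * (1 - ρ) ≤ U z → U z < θ → z ∈ C → ∀ s' : ℝ, 1 ≤ s' →
      θ * (1 - ρ) ≤ U (s' • z) → U (s' • z) < θ → s' • z ∈ C → U z + κ₀ * (θ * (1 - ρ)) * (s' - 1) ≤ U (s' • z))
    (hQ : ((volume : Measure (BlockChartSU N b)).withDensity fun z =>
        chartWeightSU b S (expJacWeightSU (kappaSU N)) z * K₀.indicator (fun w => ENNReal.ofReal (Real.exp (-A w))) z)
          (Env \ ({z | U z < θ} ∩ C))
      ≤ ENNReal.ofReal Q * ((volume : Measure (BlockChartSU N b)).withDensity fun z =>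
        chartWeightSU b S (expJacWeightSU (kappaSU N)) z * K₀.indicator (fun w => ENNReal.ofReal (Real.exp (-A w))) z)
          ({z | U z < θ} ∩ C))
    (hR : ∀ z ∈ closedBall (0 : BlockChartSU N b) S, R (expFibreChartSU b c z) =
      ({z | U z < θ} ∩ C).indicator (fun z' => K₀.indicator (fun w => ENNReal.ofReal (Real.exp (-A w))) z') z)
    (hread : ∀ z ∈ closedBall (0 : BlockChartSU N b) S, blockReading N u b x (expFibreChartSU b c z) = U z) :
    SlotAntiConcentration ((volume : Measure (BlockChartSU N b)).withDensity fun z =>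
        chartWeightSU b S (expJacWeightSU (kappaSU N)) z * R (expFibreChartSU b c z))
      (blockReading N u b x ∘ expFibreChartSU b c) θ ρ (3 * ((b.card : ℝ) * dimSU N + 1) * (1 + Q) / (κ₀ * (1 - ρ))) := by
  subst hbdef
  exact chartAC_of_sect1Letters_analyticLocal hN _ hb hS hSπ c R u x K₀ A Qf lin Vt hAm hUm hC hEnv hθ hρ0 hρ1 hρσ hκ hQ0 hL hd
    (by exact_mod_cast hM) hγ₀ hr hW hK₀ h0K₀ hexp Mq hQf
    (ineq19_blockChartSU_image_of_ineq17 hinj M hd hnM hM Qf hγ₀.le h17 hsmall)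
    ℓ hlin h16 hV Φ hVt hΦd hΦS hclause₂ hUL hUc hclause henv hRT hQ hR hread

/-- ★ **THE CUT-CHART-LAW (M1), `h19` FROM THE (1.7) ROW, ON THE OFF-TREE BLOCK OF A TORUS BOX** — file 20's ★ with `b = castBond '' (innerBonds ∖ treeBonds)` and
`ineq19_blockChartSU_image_of_ineq17`. [bookkeeping] -/
theorem cutChartLawAC_of_sect1Letters_analyticLocal_of_ineq17_image (hN : 2 ≤ N) (b : Finset (PBond P j)) (hb : b.Nonempty)
    {S : ℝ} (hS : 0 < S) (hSπ : S < Real.pi)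
    (K₀ : Set (BlockChartSU N b)) (A Qf lin Vt : BlockChartSU N b → ℝ)
    (hAm : Measurable fun z : BlockChartSU N b => K₀.indicator (fun w => ENNReal.ofReal (Real.exp (-A w))) z)
    {U : BlockChartSU N b → ℝ} (hUm : Measurable U)
    {C Env : Set (BlockChartSU N b)} (hC : MeasurableSet C) (hEnv : MeasurableSet Env)
    {θ ρ σ κ₀ Q L γ₀ B₃ M₀ A₀ p₀g Rk WV r S₂ Cc εk : ℝ} (M : ℕ) {n : Fin P.d → ℕ}
    (hθ : 0 < θ) (hρ0 : 0 < ρ) (hρ1 : ρ < 1) (hρσ : ρ + σ ≤ 1) (hκ : 0 < κ₀) (hQ0 : 0 ≤ Q) (hL : 0 < L)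
    (hd : 1 ≤ P.d) (hM : 0 < M) (hγ₀ : 0 < γ₀) (hr : 0 < r)
    (hW : 0 ≤ 3 * B₃ * M₀ * A₀ ^ 2 * p₀g ^ 2 * Real.exp (-Rk) * (100 * (M : ℝ)) ^ 4 + WV)
    (hK₀ : Convex ℝ K₀) (h0K₀ : (0 : BlockChartSU N b) ∈ K₀)
    (hexp : ∀ v ∈ K₀, A v = A 0 + 1 / 2 * Qf v + lin v + Vt v)
    (Mq : Matrix (↥b × Fin (dimSU N)) (↥b × Fin (dimSU N)) ℝ)
    (hQf : ∀ v, Qf v = (fun q : ↥b × Fin (dimSU N) => v q.1 q.2) ⬝ᵥ (Mq *ᵥ fun q => v q.1 q.2))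
    (hnM : ∀ κ, n κ ≤ 100 * M) (y : Fin P.d → ℤ)
    (hinj : Set.InjOn (fun bd : (Fin P.d → ℤ) × Fin P.d => (⟨castSite bd.1, bd.2⟩ : PBond P j)) ↑(innerBonds n y))
    (hbdef : b = (innerBonds n y \ treeBonds n y).image fun bd : (Fin P.d → ℤ) × Fin P.d => (⟨castSite bd.1, bd.2⟩ : PBond P j))
    (h17 : ∀ v : BlockChartSU N b, Ineq17 (Qf v)
      (∑ p ∈ innerPlaq n y, ∑ a : Fin (dimSU N),
        curl (fun bd => if h : (⟨castSite bd.1, bd.2⟩ : PBond P j) ∈ b then v ⟨(⟨castSite bd.1, bd.2⟩ : PBond P j), h⟩ a else (0 : ℝ))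
          p.1 p.2.1 p.2.2 ^ 2)
      (∑ i, ‖v i‖ ^ 2) γ₀ Cc M Rk εk)
    (hsmall : Cc * ((M : ℝ) ^ 6 * Rk * εk + Real.exp (-Rk)) ≤ γ₀ / (2 * P.d * (100 * (M : ℝ)) ^ (P.d + 1)))
    (ℓ : BlockChartSU N b →ₗ[ℝ] ℝ) (hlin : ∀ v, lin v = ℓ v)
    (h16 : ∀ v ∈ K₀, Ineq16 (lin v) B₃ M₀ A₀ p₀g Rk M)
    (hV : ∀ v ∈ K₀, |Vt v| ≤ WV)
    (Φ : (↥b × Fin (dimSU N) → ℂ) → ℂ)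
    (hVt : ∀ x ∈ K₀, Vt x = (Φ fun q => ((x q.1 q.2 : ℝ) : ℂ)).re)
    (hΦd : ∀ x ∈ K₀, DifferentiableOn ℂ Φ (ball (fun q => ((x q.1 q.2 : ℝ) : ℂ)) r))
    (hΦS : ∀ x ∈ K₀, ∀ u ∈ ball (fun q : ↥b × Fin (dimSU N) => ((x q.1 q.2 : ℝ) : ℂ)) r, ‖Φ u‖ ≤ S₂)
    (hclause₂ : 4 * P.d * (100 * (M : ℝ)) ^ (P.d + 1) * S₂ ≤ γ₀ * r ^ 2)
    (hUL : ∀ z z' : BlockChartSU N b, U z - U z' ≤ L * ‖z - z'‖)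
    (hUc : U 0 ≤ σ * θ)
    (hclause : 16 * (3 * B₃ * M₀ * A₀ ^ 2 * p₀g ^ 2 * Real.exp (-Rk) * (100 * (M : ℝ)) ^ 4 +
        (WV + b.card * ((N * N : ℕ) * (-2 * Real.log (Real.sinc S))))) * P.d
      * (100 * (M : ℝ)) ^ (P.d + 1) * (dimSU N * L ^ 2) ≤ γ₀ * (θ * (1 - ρ - σ)) ^ 2)
    (henv : ∀ l ∈ Icc (1 - 1 / ((b.card : ℝ) * dimSU N + 1)) 1, ∀ z : BlockChartSU N b,
      θ * (1 - ρ) ≤ U z → U z < θ → z ∈ C → l • z ∈ Env)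
    (hRT : ∀ z : BlockChartSU N b, θ * (1 - ρ) ≤ U z → U z < θ → z ∈ C → ∀ s' : ℝ, 1 ≤ s' →
      θ * (1 - ρ) ≤ U (s' • z) → U (s' • z) < θ → s' • z ∈ C → U z + κ₀ * (θ * (1 - ρ)) * (s' - 1) ≤ U (s' • z))
    (hQ : ((volume : Measure (BlockChartSU N b)).withDensity fun z =>
        chartWeightSU b S (expJacWeightSU (kappaSU N)) z * K₀.indicator (fun w => ENNReal.ofReal (Real.exp (-A w))) z)
          (Env \ ({z | U z < θ} ∩ C))
      ≤ ENNReal.ofReal Q * ((volume : Measure (BlockChartSU N b)).withDensity fun z =>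
        chartWeightSU b S (expJacWeightSU (kappaSU N)) z * K₀.indicator (fun w => ENNReal.ofReal (Real.exp (-A w))) z)
          ({z | U z < θ} ∩ C)) :
    SlotAntiConcentration
      (((volume : Measure (BlockChartSU N b)).withDensity fun z => (K₀ ∩ closedBall (0 : BlockChartSU N b) S).indicator
        (fun w => ENNReal.ofReal (Real.exp (-(A w +
          (∑ i, -Real.log (LinearMap.det (duhT (w i) : ChartSU N →ₗ[ℝ] ChartSU N))) -
            b.card * Real.log (kappaSU N).toReal)))) z).restrict ({z | U z < θ} ∩ C))
      U θ ρ (3 * ((b.card : ℝ) * dimSU N + 1) * (1 + Q) / (κ₀ * (1 - ρ))) := by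
  subst hbdef
  exact cutChartLawAC_of_sect1Letters_analyticLocal hN _ hb hS hSπ K₀ A Qf lin Vt hAm hUm hC hEnv hθ hρ0 hρ1 hρσ hκ hQ0 hL hd
    (by exact_mod_cast hM) hγ₀ hr hW hK₀ h0K₀ hexp Mq hQf
    (ineq19_blockChartSU_image_of_ineq17 hinj M hd hnM hM Qf hγ₀.le h17 hsmall)
    ℓ hlin h16 hV Φ hVt hΦd hΦS hclause₂ hUL hUc hclause henv hRT hQ

/-- ★★ **THE PER-FIBRE CHART PACKAGE OF THE KEYED ∕ TREE-GAUGE KNITS, `h19` FROM THE (1.7) ROW, ON THE OFF-TREE BLOCK OF A TORUS BOX** — file 20's ★★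
with `b = castBond '' (innerBonds ∖ treeBonds)` and `ineq19_blockChartSU_image_of_ineq17`. [bookkeeping] -/
theorem chartPackage_of_sect1Letters_analyticLocal_of_ineq17_image (hN : 2 ≤ N) (b : Finset (PBond P j)) (hb : b.Nonempty)
    (μ : Measure (↥b → SU N)) {S : ℝ} (hS : 0 < S) (hSπ : S < Real.pi) (c : GaugeField P j (SU N))
    {R : (↥b → SU N) → ℝ≥0∞} (hRm : Measurable R)
    (hlaw : μ = (blockLaw b).withDensity fun y => windowSU b c S y * R y)
    (v : (↥b → SU N) → ℝ)
    (K₀ : Set (BlockChartSU N b)) (A Qf lin Vt : BlockChartSU N b → ℝ)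
    (hAm : Measurable fun z : BlockChartSU N b => K₀.indicator (fun w => ENNReal.ofReal (Real.exp (-A w))) z)
    {U : BlockChartSU N b → ℝ} (hUm : Measurable U)
    {C Env : Set (BlockChartSU N b)} (hC : MeasurableSet C) (hEnv : MeasurableSet Env)
    {θ ρ σ κ₀ Q L γ₀ B₃ M₀ A₀ p₀g Rk WV DK r S₂ Cc εk : ℝ} (M : ℕ) {n : Fin P.d → ℕ}
    (hθ : 0 < θ) (hρ0 : 0 < ρ) (hρ1 : ρ < 1) (hρσ : ρ + σ ≤ 1) (hκ : 0 < κ₀) (hQ0 : 0 ≤ Q) (hL : 0 < L)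
    (hd : 1 ≤ P.d) (hM : 0 < M) (hγ₀ : 0 < γ₀) (hr : 0 < r)
    (hW : 0 ≤ 3 * B₃ * M₀ * A₀ ^ 2 * p₀g ^ 2 * Real.exp (-Rk) * (100 * (M : ℝ)) ^ 4 + WV)
    (hK₀ : Convex ℝ K₀) (h0K₀ : (0 : BlockChartSU N b) ∈ K₀)
    (hexp : ∀ w ∈ K₀, A w = A 0 + 1 / 2 * Qf w + lin w + Vt w)
    (Mq : Matrix (↥b × Fin (dimSU N)) (↥b × Fin (dimSU N)) ℝ)
    (hQf : ∀ w, Qf w = (fun q : ↥b × Fin (dimSU N) => w q.1 q.2) ⬝ᵥ (Mq *ᵥ fun q => w q.1 q.2))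
    (hnM : ∀ κ, n κ ≤ 100 * M) (y : Fin P.d → ℤ)
    (hinj : Set.InjOn (fun bd : (Fin P.d → ℤ) × Fin P.d => (⟨castSite bd.1, bd.2⟩ : PBond P j)) ↑(innerBonds n y))
    (hbdef : b = (innerBonds n y \ treeBonds n y).image fun bd : (Fin P.d → ℤ) × Fin P.d => (⟨castSite bd.1, bd.2⟩ : PBond P j))
    (h17 : ∀ w : BlockChartSU N b, Ineq17 (Qf w)
      (∑ p ∈ innerPlaq n y, ∑ a : Fin (dimSU N),
        curl (fun bd => if h : (⟨castSite bd.1, bd.2⟩ : PBond P j) ∈ b then w ⟨(⟨castSite bd.1, bd.2⟩ : PBond P j), h⟩ a else (0 : ℝ))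
          p.1 p.2.1 p.2.2 ^ 2)
      (∑ i, ‖w i‖ ^ 2) γ₀ Cc M Rk εk)
    (hsmall : Cc * ((M : ℝ) ^ 6 * Rk * εk + Real.exp (-Rk)) ≤ γ₀ / (2 * P.d * (100 * (M : ℝ)) ^ (P.d + 1)))
    (ℓ : BlockChartSU N b →ₗ[ℝ] ℝ) (hlin : ∀ w, lin w = ℓ w)
    (h16 : ∀ w ∈ K₀, Ineq16 (lin w) B₃ M₀ A₀ p₀g Rk M)
    (hV : ∀ w ∈ K₀, |Vt w| ≤ WV)
    (Φ : (↥b × Fin (dimSU N) → ℂ) → ℂ)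
    (hVt : ∀ x ∈ K₀, Vt x = (Φ fun q => ((x q.1 q.2 : ℝ) : ℂ)).re)
    (hΦd : ∀ x ∈ K₀, DifferentiableOn ℂ Φ (ball (fun q => ((x q.1 q.2 : ℝ) : ℂ)) r))
    (hΦS : ∀ x ∈ K₀, ∀ u ∈ ball (fun q : ↥b × Fin (dimSU N) => ((x q.1 q.2 : ℝ) : ℂ)) r, ‖Φ u‖ ≤ S₂)
    (hclause₂ : 4 * P.d * (100 * (M : ℝ)) ^ (P.d + 1) * S₂ ≤ γ₀ * r ^ 2)
    (hR : ∀ z ∈ closedBall (0 : BlockChartSU N b) S, R (expFibreChartSU b c z) =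
      ({z | U z < θ} ∩ C).indicator (fun z' => K₀.indicator (fun w => ENNReal.ofReal (Real.exp (-A w))) z') z)
    (hread : ∀ z ∈ closedBall (0 : BlockChartSU N b) S, v (expFibreChartSU b c z) = U z)
    (hUL : ∀ z z' : BlockChartSU N b, U z - U z' ≤ L * ‖z - z'‖)
    (hUc : U 0 ≤ σ * θ)
    (hclause : 16 * (3 * B₃ * M₀ * A₀ ^ 2 * p₀g ^ 2 * Real.exp (-Rk) * (100 * (M : ℝ)) ^ 4 +
        (WV + b.card * ((N * N : ℕ) * (-2 * Real.log (Real.sinc S))))) * P.d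
      * (100 * (M : ℝ)) ^ (P.d + 1) * (dimSU N * L ^ 2) ≤ γ₀ * (θ * (1 - ρ - σ)) ^ 2)
    (henv : ∀ l ∈ Icc (1 - 1 / ((b.card : ℝ) * dimSU N + 1)) 1, ∀ z : BlockChartSU N b,
      θ * (1 - ρ) ≤ U z → U z < θ → z ∈ C → l • z ∈ Env)
    (hRT : ∀ z : BlockChartSU N b, θ * (1 - ρ) ≤ U z → U z < θ → z ∈ C → ∀ s' : ℝ, 1 ≤ s' →
      θ * (1 - ρ) ≤ U (s' • z) → U (s' • z) < θ → s' • z ∈ C → U z + κ₀ * (θ * (1 - ρ)) * (s' - 1) ≤ U (s' • z))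
    (hQ : ((volume : Measure (BlockChartSU N b)).withDensity fun z =>
        chartWeightSU b S (expJacWeightSU (kappaSU N)) z * K₀.indicator (fun w => ENNReal.ofReal (Real.exp (-A w))) z)
          (Env \ ({z | U z < θ} ∩ C))
      ≤ ENNReal.ofReal Q * ((volume : Measure (BlockChartSU N b)).withDensity fun z =>
        chartWeightSU b S (expJacWeightSU (kappaSU N)) z * K₀.indicator (fun w => ENNReal.ofReal (Real.exp (-A w))) z)
          ({z | U z < θ} ∩ C))
    (hD : 3 * ((b.card : ℝ) * dimSU N + 1) * (1 + Q) / (κ₀ * (1 - ρ)) ≤ DK) :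
    ∃ (S' : ℝ) (c' : GaugeField P j (SU N)) (R' : (↥b → SU N) → ℝ≥0∞) (U' : BlockChartSU N b → ℝ)
      (A' : Set (BlockChartSU N b)) (f : BlockChartSU N b → ℝ≥0∞) (D : ℝ),
      0 ≤ S' ∧ S' ≤ Real.pi ∧ Measurable R' ∧
      μ = (blockLaw b).withDensity (fun y => windowSU b c' S' y * R' y) ∧
      MeasurableSet A' ∧
      (∀ z ∈ closedBall (0 : BlockChartSU N b) S', v (expFibreChartSU b c' z) = U' z) ∧
      ((fun z : BlockChartSU N b => chartWeightSU b S' (expJacWeightSU (kappaSU N)) z * R' (expFibreChartSU b c' z))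
        =ᵐ[volume] A'.indicator f) ∧
      SlotAntiConcentration (((volume : Measure (BlockChartSU N b)).withDensity f).restrict A') U' θ ρ D ∧
      D ≤ DK := by
  subst hbdef
  exact chartPackage_of_sect1Letters_analyticLocal hN _ hb μ hS hSπ c hRm hlaw v K₀ A Qf lin Vt hAm hUm hC hEnv hθ hρ0 hρ1 hρσ hκ hQ0 hL
    hd (by exact_mod_cast hM) hγ₀ hr hW hK₀ h0K₀ hexp Mq hQf
    (ineq19_blockChartSU_image_of_ineq17 hinj M hd hnM hM Qf hγ₀.le h17 hsmall)
    ℓ hlin h16 hV Φ hVt hΦd hΦS hclause₂ hR hread hUL hUc hclause henv hRT hQ hD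

end Summit.QuantumFields.YangMills.Theorems.N21LowCentreEndAtSUNBlockChartPackageCoerciveAxialComb

end
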